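import Literature.NumberTheory.ComplexMultiplication.FaltingsTateOfCMElliptic
import Summits.HodgeConjecture.HodgeConjecture.Theorems.HCCMUnconditionalShimuraThm18_6Holds
import HarnessLib

/-!
# T5 §6.5′ — [Faltings 1983, §5 Kor. 1] at a CM-elliptic pair, UNCONDITIONALLY

Cell hodgecm-mathlib, fan A, binder hLiu418 (item stmt-HodgeConjecture-24832).  Row VI-1 of the floor is
the printed citation `hFal : ∀ {K} [Field K] (A B : AbelianVariety K) ℓ, faltings_tate_bijective A B ℓ`
([Fal83 §5 Kor. 1], `FaltingsAbelian.lean`).  This file decides its FIRST INSTANCE in the tree with no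
hypothesis: for every structure `(A₀, ι₀ : 𝓞_K → End A₀)` of CM type `(K, Φ)` over a number field
`k ⊇ K*` with `[K : ℚ] = 2` (a CM elliptic curve with CM by `𝓞_K` defined over `k`) and every prime
`ℓ`, `faltings_tate_bijective A₀ A₀ ℓ` — the Literature head
`faltings_tate_bijective_of_CM_elliptic_of_thm18_6` (Serre–Tate §4 Cor. 1 in rank one, fed by a
Shimura–Taniyama Frobenius generating `K`) with its hypothesis `shimura1998_thm18_6` discharged by the
tree's theorem `shimura1998_thm18_6_holds` (row II-1).  Witness rung only: the floor consumes VI-1 at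
the pair (Albanese of the compact unitary Shimura variety, Def 4.5 CM abelian variety), which is not of
this shape; no floor binder moves.  The `faltings_isogeny` v5 slot `hFal_rung_CM_elliptic` closes
`:= faltings_tate_bijective_of_CM_elliptic`.

HC_CM is proved only modulo the printed citations of the floor until rung 0 closes.
-/

-- mandated namespace `Summit.HodgeConjecture.HodgeConjecture.Theorems` trips `linter.dupNamespace` (single-problem
-- summit); off as in `HCCMUnconditionalShimuraThm18_6Holds.lean`.
set_option linter.dupNamespace false

open CategoryTheory NumberField
open scoped NumberField

namespace Summit.HodgeConjecture.HodgeConjecture.Theorems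

open Literature.AlgebraicGeometry.Motives
open Literature.NumberTheory.ComplexMultiplication

/-- **[Faltings 1983, §5 Korollar 1] for the endomorphisms of a CM elliptic structure over a number
field, unconditionally** — `ℤ_ℓ ⊗ End_k(A₀) → End_{Γ_k}(T_ℓ A₀)` is bijective for `(A₀, ι₀)` of CM type
`(K, Φ)` over `k`, `[K : ℚ] = 2`, every prime `ℓ`: the Literature head fed with
`shimura1998_thm18_6_holds`.  First decided instance of the floor's VI-1 text.
[cite: Faltings1983Endlichkeit, §5 Korollar 1] [cite: SerreTate1968, §4 Theorem 5 and Corollary 1]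
[cite: Shimura1998, §18.6 Theorem 18.6] -/
theorem faltings_tate_bijective_of_CM_elliptic :
    ∀ {k : Type} [Field k] [Algebra k ℂ] {K : Type} [Field K] [NumberField K]
      [IsCMField K] (Φ : CMType K) (A₀ : AbelianVariety k) (ι₀ : 𝓞 K →+* End A₀),
      IsCMTypeRealisationOver Φ A₀ ι₀ → Module.finrank ℚ K = 2 →
      ∀ (ℓ : ℕ) [Fact ℓ.Prime], faltings_tate_bijective A₀ A₀ ℓ :=
  Literature.NumberTheory.ComplexMultiplication.faltings_tate_bijective_of_CM_elliptic_of_thm18_6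
    shimura1998_thm18_6_holds

end Summit.HodgeConjecture.HodgeConjecture.Theorems
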